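import Summits.AtomisticToContinuum.BoseEinsteinCondensation.Theorems.BECHusimiAmplitudeGasPositivityReductionStability
import Literature.Barriers.AtomisticToContinuum.KineticGapLengthScalesScaling
import HarnessLib

/-!
# Crux `CorrectorClosure` (stmt-AtomisticToContinuum-12058), line `volume-homotopy-sum-rule-domination` —
# registered stub `stub_volumeBootstrap` (S5), auxiliary file: local constancy of `n₀` in the side (dilation)

Supports (does not close) stmt-AtomisticToContinuum-12058, route `BECInsertionCorrector`.

The fixed-`N` continuity input of the volume bootstrap (`stub_volumeBootstrap`: the dichotomy
`n₀ ∉ (N/4, 3N/4)` for the torus minimisers at every side `L ≥ L₀` forces `n₀ ≥ 3N/4` at every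
`L ≥ L₀`), WITHOUT any uniformity in `N` and without perturbation theory of the spectrum:

* `vb_localConstancy` — **local constancy of `n₀` along the side**: for `L₁ > 0` and `ε > 0` there is
  `r > 0` such that exact minimisers `Ψ'` at any side `L'` with `|L' - L₁| < r` and `Ψ₁` at `L₁` satisfy
  `n₀(Ψ') ≤ n₀(Ψ₁) + εN` and `n₀(Ψ₁) ≤ n₀(Ψ') + εN`.

Mechanism. The dilation `Ψ'_b = b^{-3N/2}Ψ'(·/b)`, `b = L₁/L'` (the tree's `PeriodicTrialState.dilate` of
`Literature/Barriers/AtomisticToContinuum/KineticGapLengthScalesScaling.lean`) has the same `n₀`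
(`condensateOccupation_dilate`) and is an EXACT minimiser at side `L₁` of the scaled potential `b⁻²v(·/b)`
(`periodicEnergy_dilate`, `periodicGroundStateEnergy_scaledPotential`). The smooth class (`v` finite,
`x ↦ v(|x|)` continuous, finite range `R₀`) makes `x ↦ v(|x|)` bounded and uniformly continuous
(`HasCompactSupport.uniformContinuous_of_continuous`), so `b⁻²v(|x|/b)` is uniformly `ε'`-close to `v(|x|)`
on `|x| ≤ 2R` (`R = max R₀ 0`) and both vanish beyond, for `b` close to `1` (`vb_scaledPotential_close`);
periodising termwise (`vb_periodizedPotential_le_of_pointwise`) and counting the lattice images within `2R`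
by the periodisation of an indicator (`exists_bound_periodizedPotential`, bound `C`), the two interactions
differ by at most `N²ε'C` on every configuration (`vb_periodicInteraction_le_of_periodized_le`), hence so
do the two energy functionals on normalised states and the two ground-state energies
(`vb_periodicEnergy_le_of_interaction_le`, `vb_groundStateEnergy_le_of_interaction_le`), and `Ψ'_b` is a
`2N²ε'C`-near-minimiser of `v` at side `L₁` (`vb_nearMinimiser_of_minimiser`). With `2N²ε'C ≤ δ`, the
tolerance of the tree's `condensateOccupation_le_of_nearMinimisers` (variational simplicity of the bosonic
torus ground state, applied to the symmetrised profile `r ↦ v(|r|)`, which has the same periodisation and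
is bounded on all of `ℝ`), the two `δ`-near-minimisers `Ψ'_b`, `Ψ₁` at `(N, L₁)` have `n₀` within `εN`.

## References

* [LSSY2005] E. H. Lieb, R. Seiringer, J. P. Solovej, J. Yngvason, *The Mathematics of the Bose Gas and
  its Condensation*, Birkhäuser (2005): Ch. 5, footnote to (5.3) (scaling of the torus problem).
* [ReedSimonIV1978] M. Reed, B. Simon, *Methods of Modern Mathematical Physics IV*, Academic Press (1978),
  Thm XIII.1 and §XIII.12 (nondegenerate ground states; behind `condensateOccupation_le_of_nearMinimisers`).
-/

noncomputable section

open MeasureTheory Filter Set Metric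
open scoped ENNReal NNReal Topology

namespace Summit.AtomisticToContinuum.BoseEinsteinCondensation.Theorems.CorrectorClosure.VolumeHomotopySumRuleDomination

open Literature.MathematicalPhysics.QuantumManyBody.BoseGas
open Literature.Barriers.AtomisticToContinuum.BoseGas (scaledPotential periodicEnergy_dilate
  condensateOccupation_dilate periodicGroundStateEnergy_scaledPotential)

/-! ### Comparison of two potentials on one torus -/

section Comparison

variable {N : ℕ} {L : ℝ}

/-- A pointwise bound `w(|x|) ≤ v(|x|) + e·u(|x|)` periodises termwise:
`w^per ≤ v^per + e·u^per`. [folklore] -/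
theorem vb_periodizedPotential_le_of_pointwise {v w u : ℝ → ℝ≥0∞} {e : ℝ≥0∞}
    (h : ∀ x : Space, w ‖x‖ ≤ v ‖x‖ + e * u ‖x‖) (L : ℝ) (y : Space) :
    periodizedPotential w L y ≤ periodizedPotential v L y + e * periodizedPotential u L y := by
  unfold periodizedPotential
  rw [← ENNReal.tsum_mul_left, ← ENNReal.tsum_add]
  exact ENNReal.tsum_le_tsum fun n => h _

/-- A uniform bound `w^per ≤ v^per + D` sums over the pairs: `W_w ≤ W_v + N²D`. [folklore] -/
theorem vb_periodicInteraction_le_of_periodized_le {v w : ℝ → ℝ≥0∞} {L : ℝ} {D : ℝ≥0∞}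
    (h : ∀ y : Space, periodizedPotential w L y ≤ periodizedPotential v L y + D) (X : Config N) :
    periodicInteraction w L X ≤ periodicInteraction v L X + ((N * N : ℕ) : ℝ≥0∞) * D := by
  unfold periodicInteraction
  calc ∑ i : Fin N, ∑ j ∈ Finset.univ.filter (fun j : Fin N => i < j), periodizedPotential w L (X i - X j)
      ≤ ∑ i : Fin N, ∑ j ∈ Finset.univ.filter (fun j : Fin N => i < j),
          (periodizedPotential v L (X i - X j) + D) :=
        Finset.sum_le_sum fun i _ => Finset.sum_le_sum fun j _ => h _
    _ = (∑ i : Fin N, ∑ j ∈ Finset.univ.filter (fun j : Fin N => i < j),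
          periodizedPotential v L (X i - X j)) +
          ∑ i : Fin N, ∑ _j ∈ Finset.univ.filter (fun j : Fin N => i < j), D := by
        rw [← Finset.sum_add_distrib]
        exact Finset.sum_congr rfl fun i _ => Finset.sum_add_distrib
    _ ≤ (∑ i : Fin N, ∑ j ∈ Finset.univ.filter (fun j : Fin N => i < j),
          periodizedPotential v L (X i - X j)) + ∑ _i : Fin N, ∑ _j : Fin N, D := by
        refine add_le_add le_rfl (Finset.sum_le_sum fun i _ => ?_)
        exact Finset.sum_le_sum_of_subset_of_nonneg (Finset.filter_subset (fun j : Fin N => i < j) _)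
          fun _ _ _ => (zero_le : (0 : ℝ≥0∞) ≤ D)
    _ = _ := by
        simp only [Finset.sum_const, Finset.card_univ, Fintype.card_fin, nsmul_eq_mul, Nat.cast_mul,
          mul_assoc]

/-- **Energies of two potentials with close interactions are close**: if `W_w ≤ W_v + D` on every
configuration then `E_w(Φ) ≤ E_v(Φ) + D` for every (normalised) trial state. [folklore] -/
theorem vb_periodicEnergy_le_of_interaction_le {v w : ℝ → ℝ≥0∞} {D : ℝ≥0∞}
    (h : ∀ X : Config N, periodicInteraction w L X ≤ periodicInteraction v L X + D)
    (Φ : PeriodicTrialState N L) : periodicEnergy w Φ ≤ periodicEnergy v Φ + D := by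
  unfold periodicEnergy
  have hm : Measurable fun X => (‖Φ.ψ X‖₊ : ℝ≥0∞) ^ 2 := measurable_normSq Φ.contDiff.continuous
  calc ∫⁻ X in cellN N L, kineticDensity Φ.ψ X + periodicInteraction w L X * (‖Φ.ψ X‖₊ : ℝ≥0∞) ^ 2
      ≤ ∫⁻ X in cellN N L, (kineticDensity Φ.ψ X + periodicInteraction v L X * (‖Φ.ψ X‖₊ : ℝ≥0∞) ^ 2) +
          D * (‖Φ.ψ X‖₊ : ℝ≥0∞) ^ 2 := by
        refine lintegral_mono fun X => ?_
        rw [add_assoc, ← add_mul]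
        exact add_le_add le_rfl (mul_le_mul' (h X) le_rfl)
    _ = (∫⁻ X in cellN N L, kineticDensity Φ.ψ X + periodicInteraction v L X * (‖Φ.ψ X‖₊ : ℝ≥0∞) ^ 2) +
          D * ∫⁻ X in cellN N L, (‖Φ.ψ X‖₊ : ℝ≥0∞) ^ 2 := by
        rw [lintegral_add_right _ (hm.const_mul D), lintegral_const_mul D hm]
    _ = _ := by rw [Φ.norm_eq, mul_one]

/-- The same for the ground-state energies: `E₀(w) ≤ E₀(v) + D`. [folklore] -/
theorem vb_groundStateEnergy_le_of_interaction_le {v w : ℝ → ℝ≥0∞} {D : ℝ≥0∞}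
    (h : ∀ X : Config N, periodicInteraction w L X ≤ periodicInteraction v L X + D) :
    periodicGroundStateEnergy w N L ≤ periodicGroundStateEnergy v N L + D := by
  unfold periodicGroundStateEnergy
  rw [ENNReal.iInf_add]
  exact iInf_mono fun Φ => vb_periodicEnergy_le_of_interaction_le h Φ

/-- **A minimiser of `w` is a `2D`-near-minimiser of `v`** when the interactions are `D`-close both
ways. [folklore] -/
theorem vb_nearMinimiser_of_minimiser {v w : ℝ → ℝ≥0∞} {D : ℝ≥0∞}
    (hwv : ∀ X : Config N, periodicInteraction w L X ≤ periodicInteraction v L X + D)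
    (hvw : ∀ X : Config N, periodicInteraction v L X ≤ periodicInteraction w L X + D)
    (Φ : PeriodicTrialState N L) (hΦ : periodicEnergy w Φ = periodicGroundStateEnergy w N L) :
    periodicEnergy v Φ ≤ periodicGroundStateEnergy v N L + 2 * D := by
  calc periodicEnergy v Φ ≤ periodicEnergy w Φ + D := vb_periodicEnergy_le_of_interaction_le hvw Φ
    _ = periodicGroundStateEnergy w N L + D := by rw [hΦ]
    _ ≤ periodicGroundStateEnergy v N L + D + D :=
        add_le_add (vb_groundStateEnergy_le_of_interaction_le hwv) le_rfl
    _ = periodicGroundStateEnergy v N L + 2 * D := by rw [two_mul, add_assoc]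

end Comparison

/-! ### The smooth class: `b⁻²v(·/b)` is uniformly close to `v` -/

/-- **Uniform closeness of the scaled potential.** For a finite profile `v` of range `R₀` with
`x ↦ v(|x|)` continuous on `ℝ³` and `ε > 0` there is `η > 0` such that for `|b - 1| < η` and every `x`:
`b⁻²v(|x|/b)` and `v(|x|)` differ by at most `ε` where `|x| ≤ 2R` (`R = max R₀ 0`) and both vanish
beyond; written as two one-sided bounds with the indicator of `|x| ≤ 2R` (uniform continuity and
boundedness of the compactly supported continuous `x ↦ v(|x|)`). [folklore] -/
theorem vb_scaledPotential_close {v : ℝ → ℝ≥0∞} (hfin : ∀ r, v r ≠ ⊤)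
    (hcont : Continuous fun x : Space => (v ‖x‖).toReal) {R₀ : ℝ} (hR₀ : ∀ r, R₀ < r → v r = 0)
    {ε : ℝ} (hε : 0 < ε) :
    ∃ η : ℝ, 0 < η ∧ ∀ b : ℝ, |b - 1| < η → ∀ x : Space,
      scaledPotential v b ‖x‖ ≤
          v ‖x‖ + ENNReal.ofReal ε * (Set.Iic (2 * max R₀ 0)).indicator (1 : ℝ → ℝ≥0∞) ‖x‖ ∧
        v ‖x‖ ≤ scaledPotential v b ‖x‖ +
          ENNReal.ofReal ε * (Set.Iic (2 * max R₀ 0)).indicator (1 : ℝ → ℝ≥0∞) ‖x‖ := by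
  set R := max R₀ 0 with hR
  have hR0 : 0 ≤ R := le_max_right _ _
  have hRR₀ : R₀ ≤ R := le_max_left _ _
  set V : Space → ℝ := fun x => (v ‖x‖).toReal with hV
  -- bounded, nonnegative, compactly supported, uniformly continuous
  obtain ⟨M, hM⟩ := exists_bound_of_continuous_finiteRange hfin hcont hR₀
  have hVM : ∀ x, V x ≤ M := fun x => by
    have h := ENNReal.toReal_mono ENNReal.coe_ne_top (hM x)
    rwa [ENNReal.coe_toReal] at h
  have hV0 : ∀ x, 0 ≤ V x := fun x => ENNReal.toReal_nonneg
  have hVsupp : ∀ x : Space, R < ‖x‖ → V x = 0 := fun x hx => by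
    simp only [hV, hR₀ _ (hRR₀.trans_lt hx), ENNReal.toReal_zero]
  have hUC : UniformContinuous V := by
    refine HasCompactSupport.uniformContinuous_of_continuous ?_ hcont
    refine HasCompactSupport.intro (isCompact_closedBall (0 : Space) R) fun x hx => hVsupp x ?_
    rw [mem_closedBall, dist_zero_right, not_le] at hx
    exact hx
  obtain ⟨θ, hθ0, hθ⟩ := Metric.uniformContinuous_iff.1 hUC (ε / 8) (by positivity)
  -- the radius
  set η : ℝ := min (1 / 2) (min (θ / (4 * R + 1)) (ε / (20 * M + 1))) with hη
  have hη0 : 0 < η := by positivity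
  refine ⟨η, hη0, fun b hb x => ?_⟩
  have hη1 : η ≤ 1 / 2 := min_le_left _ _
  have hη2 : η ≤ θ / (4 * R + 1) := (min_le_right _ _).trans (min_le_left _ _)
  have hη3 : η ≤ ε / (20 * M + 1) := (min_le_right _ _).trans (min_le_right _ _)
  have hb1 : 1 / 2 < b := by linarith [(abs_lt.1 (hb.trans_le hη1)).1]
  have hb2 : b < 3 / 2 := by linarith [(abs_lt.1 (hb.trans_le hη1)).2]
  have hb0 : 0 < b := by linarith
  -- value of the scaled potential at `|x|`
  have hsv : scaledPotential v b ‖x‖ = ENNReal.ofReal (b ^ 2)⁻¹ * v ‖b⁻¹ • x‖ := by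
    simp only [scaledPotential]
    rw [norm_smul, norm_inv, Real.norm_of_nonneg hb0.le, ENNReal.ofReal_inv_of_pos (by positivity),
      div_eq_inv_mul]
  by_cases hx : ‖x‖ ≤ 2 * R
  · -- inside `|x| ≤ 2R`: the two values are `ε`-close
    have hind : (Set.Iic (2 * R)).indicator (1 : ℝ → ℝ≥0∞) ‖x‖ = 1 :=
      Set.indicator_of_mem (show ‖x‖ ∈ Set.Iic (2 * R) from hx) _
    rw [hind, mul_one, hsv]
    have hp : v ‖b⁻¹ • x‖ = ENNReal.ofReal (V (b⁻¹ • x)) := (ENNReal.ofReal_toReal (hfin _)).symm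
    have hq : v ‖x‖ = ENNReal.ofReal (V x) := (ENNReal.ofReal_toReal (hfin _)).symm
    -- `|V(x/b) - V(x)| < ε/8`
    have hdist : dist (b⁻¹ • x) x < θ := by
      rw [dist_eq_norm, show b⁻¹ • x - x = (b⁻¹ - 1) • x by rw [sub_smul, one_smul], norm_smul,
        Real.norm_eq_abs]
      have h1 : |b⁻¹ - 1| ≤ 2 * |b - 1| := by
        rw [show b⁻¹ - 1 = (1 - b) / b by field_simp, abs_div, abs_of_pos hb0, abs_sub_comm,
          div_le_iff₀ hb0]
        nlinarith [abs_nonneg (b - 1)]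
      have h2 : |b - 1| < θ / (4 * R + 1) := hb.trans_le hη2
      rw [lt_div_iff₀ (by positivity)] at h2
      calc |b⁻¹ - 1| * ‖x‖ ≤ 2 * |b - 1| * (2 * R) :=
            mul_le_mul h1 hx (norm_nonneg _) (by positivity)
        _ < θ := by nlinarith [abs_nonneg (b - 1)]
    have hpq : |V (b⁻¹ • x) - V x| < ε / 8 := by
      have h := hθ hdist
      rwa [Real.dist_eq] at h
    -- `|b⁻² - 1| ≤ 10 |b - 1|`
    have hb3 : |(b ^ 2)⁻¹ - 1| ≤ 10 * |b - 1| := by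
      rw [show (b ^ 2)⁻¹ - 1 = (1 - b) * (1 + b) / b ^ 2 by field_simp; ring, abs_div, abs_mul,
        abs_of_pos (by positivity : (0 : ℝ) < b ^ 2), abs_sub_comm,
        abs_of_pos (by linarith : (0 : ℝ) < 1 + b), div_le_iff₀ (by positivity)]
      have h1 : 1 + b ≤ 10 * b ^ 2 := by nlinarith
      nlinarith [abs_nonneg (b - 1)]
    have hkey : |(b ^ 2)⁻¹ * V (b⁻¹ • x) - V x| ≤ ε := by
      have h1 : (b ^ 2)⁻¹ * V (b⁻¹ • x) - V x =
          (b ^ 2)⁻¹ * (V (b⁻¹ • x) - V x) + ((b ^ 2)⁻¹ - 1) * V x := by ring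
      have hb4 : (b ^ 2)⁻¹ ≤ 4 := by
        rw [inv_le_comm₀ (by positivity) (by norm_num)]
        nlinarith
      have hqM : |V x| ≤ M := by
        rw [abs_of_nonneg (hV0 x)]
        exact hVM x
      have hε2 : 10 * |b - 1| * M ≤ ε / 2 := by
        have h3 : |b - 1| < ε / (20 * M + 1) := hb.trans_le hη3
        rw [lt_div_iff₀ (by positivity)] at h3
        nlinarith [abs_nonneg (b - 1), M.coe_nonneg]
      rw [h1]
      calc |(b ^ 2)⁻¹ * (V (b⁻¹ • x) - V x) + ((b ^ 2)⁻¹ - 1) * V x|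
          ≤ |(b ^ 2)⁻¹ * (V (b⁻¹ • x) - V x)| + |((b ^ 2)⁻¹ - 1) * V x| := abs_add_le _ _
        _ = (b ^ 2)⁻¹ * |V (b⁻¹ • x) - V x| + |(b ^ 2)⁻¹ - 1| * |V x| := by
            rw [abs_mul, abs_mul, abs_of_pos (by positivity : (0 : ℝ) < (b ^ 2)⁻¹)]
        _ ≤ 4 * (ε / 8) + 10 * |b - 1| * M :=
            add_le_add (mul_le_mul hb4 hpq.le (abs_nonneg _) (by norm_num))
              (mul_le_mul hb3 hqM (abs_nonneg _) (by positivity))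
        _ ≤ ε := by linarith
    have hp0 : 0 ≤ (b ^ 2)⁻¹ * V (b⁻¹ • x) := mul_nonneg (by positivity) (hV0 _)
    constructor
    · rw [hp, ← ENNReal.ofReal_mul (by positivity), hq, ← ENNReal.ofReal_add (hV0 x) hε.le]
      exact ENNReal.ofReal_le_ofReal (by linarith [(abs_le.1 hkey).2])
    · rw [hp, ← ENNReal.ofReal_mul (by positivity), hq, ← ENNReal.ofReal_add hp0 hε.le]
      exact ENNReal.ofReal_le_ofReal (by linarith [(abs_le.1 hkey).1])
  · -- outside: both vanish
    rw [not_le] at hx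
    have hx1 : v ‖x‖ = 0 := hR₀ _ (by linarith)
    have hx2 : v ‖b⁻¹ • x‖ = 0 := by
      apply hR₀
      rw [norm_smul, norm_inv, Real.norm_of_nonneg hb0.le, ← div_eq_inv_mul, lt_div_iff₀ hb0]
      have h1 : R₀ * b ≤ R * b := mul_le_mul_of_nonneg_right hRR₀ hb0.le
      nlinarith
    rw [hsv, hx1, hx2, mul_zero]
    exact ⟨zero_le, zero_le⟩

/-! ### Local constancy of `n₀` along the side -/

/-- **Local constancy of the condensate occupation of the minimisers in the side `L`** (fixed `N`,
smooth class: `v` measurable of finite range, finite, `x ↦ v(|x|)` continuous). For `L₁ > 0` and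
`ε > 0` there is `r > 0` such that for every side `L'` with `|L' - L₁| < r`, every exact minimiser `Ψ'`
at `(N, L')` and every exact minimiser `Ψ₁` at `(N, L₁)` satisfy `n₀(Ψ') ≤ n₀(Ψ₁) + εN` and
`n₀(Ψ₁) ≤ n₀(Ψ') + εN`. Proof: dilate `Ψ'` to side `L₁` (same `n₀`, exact minimiser of the scaled
potential `b⁻²v(·/b)`, `b = L₁/L'`), compare the two potentials on the torus of side `L₁`
(`vb_scaledPotential_close`, at most `C` lattice images within `2R`), and apply the near-minimiser
stability `condensateOccupation_le_of_nearMinimisers` at `(N, L₁)` to the symmetrised profile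
`r ↦ v(|r|)` (same periodisation). [folklore] -/
theorem vb_localConstancy {v : ℝ → ℝ≥0∞} (hv : IsRepulsiveFiniteRange v) (hfin : ∀ r, v r ≠ ⊤)
    (hcont : Continuous fun x : Space => (v ‖x‖).toReal) (N : ℕ) {L₁ : ℝ} (hL₁ : 0 < L₁)
    {ε : ℝ} (hε : 0 < ε) :
    ∃ r : ℝ, 0 < r ∧ ∀ L' : ℝ, |L' - L₁| < r →
      ∀ (Ψ' : PeriodicTrialState N L') (Ψ₁ : PeriodicTrialState N L₁),
        periodicEnergy v Ψ' = periodicGroundStateEnergy v N L' →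
        periodicEnergy v Ψ₁ = periodicGroundStateEnergy v N L₁ →
        condensateOccupation N L' Ψ'.ψ ≤ condensateOccupation N L₁ Ψ₁.ψ + ENNReal.ofReal (ε * N) ∧
          condensateOccupation N L₁ Ψ₁.ψ ≤ condensateOccupation N L' Ψ'.ψ + ENNReal.ofReal (ε * N) := by
  obtain ⟨hmeas, R₀, hR₀⟩ := hv
  set R := max R₀ 0 with hR
  -- the symmetrised profile `u r = v |r|`: same periodisation, bounded on all of `ℝ`
  set u : ℝ → ℝ≥0∞ := fun r => v |r| with hu
  have hu_meas : Measurable u := hmeas.comp continuous_abs.measurable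
  have hu_fin : ∀ r, u r ≠ ⊤ := fun r => hfin _
  have hu_cont : Continuous fun x : Space => (u ‖x‖).toReal := by
    simp only [hu, abs_norm]
    exact hcont
  have huR : ∀ r, R₀ < r → u r = 0 := fun r hr => hR₀ _ (hr.trans_le (le_abs_self r))
  obtain ⟨M, hM⟩ := exists_bound_of_continuous_finiteRange hu_fin hu_cont huR
  have huM : ∀ r, u r ≤ M := fun r => by
    have h := hM (EuclideanSpace.single 0 r)
    have hn : ‖EuclideanSpace.single (0 : Fin 3) r‖ = |r| := by
      rw [EuclideanSpace.norm_eq]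
      simp [Real.sqrt_sq_eq_abs]
    rw [hn] at h
    simpa only [hu, abs_abs] using h
  have hE : ∀ {L : ℝ} (Φ : PeriodicTrialState N L), periodicEnergy u Φ = periodicEnergy v Φ := by
    intro L Φ
    unfold periodicEnergy periodicInteraction periodizedPotential
    simp only [hu, abs_norm]
  have hE₀ : ∀ L : ℝ, periodicGroundStateEnergy u N L = periodicGroundStateEnergy v N L := fun L => by
    unfold periodicGroundStateEnergy
    exact iInf_congr fun Φ => hE Φ
  -- the number of lattice images within `2R` is bounded at side `L₁`
  set cut : ℝ → ℝ≥0∞ := (Set.Iic (2 * R)).indicator (1 : ℝ → ℝ≥0∞) with hcut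
  have hcut1 : ∀ r, cut r ≤ (1 : ℝ≥0) := fun r => by
    rw [hcut, ENNReal.coe_one]
    exact Set.indicator_apply_le' (fun _ => le_rfl) fun _ => zero_le_one
  have hcutR : ∀ r, 2 * R < r → cut r = 0 := fun r hr =>
    Set.indicator_of_notMem (show r ∉ Set.Iic (2 * R) from not_le.2 hr) _
  obtain ⟨C, hC⟩ := exists_bound_periodizedPotential hL₁ hcut1 hcutR
  -- the tolerance of near-minimiser stability at `(N, L₁)` for `u`
  obtain ⟨δ, hδ0, hδ⟩ := condensateOccupation_le_of_nearMinimisers hu_meas huR huM N hL₁ hε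
  obtain ⟨δ', hδ'0, hδ'⟩ : ∃ δ' : ℝ, 0 < δ' ∧ ENNReal.ofReal δ' ≤ δ := by
    obtain ⟨q, _, hq1, hq2⟩ := ENNReal.lt_iff_exists_real_btwn.1 hδ0
    exact ⟨q, ENNReal.ofReal_pos.1 hq1, hq2.le⟩
  -- `ε'` with `2N²ε'C ≤ δ'`
  set ε' : ℝ := δ' / (2 * ((N * N : ℕ) : ℝ) * C + 2) with hε'
  have hε'0 : 0 < ε' := by positivity
  have hD : 2 * (((N * N : ℕ) : ℝ≥0∞) * (ENNReal.ofReal ε' * C)) ≤ δ := by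
    have h1 : 2 * (((N * N : ℕ) : ℝ≥0∞) * (ENNReal.ofReal ε' * C)) =
        ENNReal.ofReal (2 * (((N * N : ℕ) : ℝ) * (ε' * C))) := by
      rw [ENNReal.ofReal_mul (by norm_num), ENNReal.ofReal_mul (Nat.cast_nonneg _),
        ENNReal.ofReal_mul hε'0.le, ENNReal.ofReal_ofNat, ENNReal.ofReal_natCast,
        ENNReal.ofReal_coe_nnreal]
    rw [h1]
    refine (ENNReal.ofReal_le_ofReal ?_).trans hδ'
    have hC0 : (0 : ℝ) ≤ C := C.coe_nonneg
    have hNN : (0 : ℝ) ≤ ((N * N : ℕ) : ℝ) := Nat.cast_nonneg _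
    rw [hε', show (2 : ℝ) * (((N * N : ℕ) : ℝ) * (δ' / (2 * ((N * N : ℕ) : ℝ) * C + 2) * C)) =
        δ' * ((2 * ((N * N : ℕ) : ℝ) * C) / (2 * ((N * N : ℕ) : ℝ) * C + 2)) by ring]
    refine mul_le_of_le_one_right hδ'0.le ?_
    rw [div_le_one (by positivity)]
    linarith
  -- `η` from the uniform closeness of `b⁻²u(·/b)` and `u`
  obtain ⟨η, hη0, hη⟩ := vb_scaledPotential_close hu_fin hu_cont huR hε'0
  -- the radius
  refine ⟨min (L₁ / 2) (η * L₁ / 2), by positivity, fun L' hL' Ψ' Ψ₁ hΨ' hΨ₁ => ?_⟩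
  have hr1 : |L' - L₁| < L₁ / 2 := hL'.trans_le (min_le_left _ _)
  have hr2 : |L' - L₁| < η * L₁ / 2 := hL'.trans_le (min_le_right _ _)
  have hL'ge : L₁ / 2 < L' := by linarith [(abs_lt.1 hr1).1]
  have hL'pos : 0 < L' := by linarith
  set b : ℝ := L₁ / L' with hb
  have hb0 : 0 < b := div_pos hL₁ hL'pos
  have hbL : L₁ = b * L' := by rw [hb, div_mul_cancel₀ _ hL'pos.ne']
  have hb1 : |b - 1| < η := by
    rw [hb, show L₁ / L' - 1 = (L₁ - L') / L' by field_simp, abs_div, abs_of_pos hL'pos,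
      div_lt_iff₀ hL'pos, abs_sub_comm]
    calc |L' - L₁| < η * L₁ / 2 := hr2
      _ = η * (L₁ / 2) := by ring
      _ ≤ η * L' := by gcongr
  -- the dilated minimiser: an exact minimiser of the scaled potential at side `L₁`, same `n₀`
  set Φ : PeriodicTrialState N L₁ := Ψ'.dilate b hb0 hbL with hΦ
  have hGS : periodicGroundStateEnergy (scaledPotential u b) N L₁ =
      (ENNReal.ofReal (b ^ 2))⁻¹ * periodicGroundStateEnergy u N L' := by
    have h := periodicGroundStateEnergy_scaledPotential (M := L') hb0 u N
    rwa [← hbL] at h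
  have hΦmin : periodicEnergy (scaledPotential u b) Φ =
      periodicGroundStateEnergy (scaledPotential u b) N L₁ := by
    rw [hΦ, periodicEnergy_dilate hb0 hbL u Ψ', hE Ψ', hΨ', ← hE₀ L', hGS]
  have hn : condensateOccupation N L₁ Φ.ψ = condensateOccupation N L' Ψ'.ψ :=
    condensateOccupation_dilate hb0 hbL hL'pos Ψ'
  -- the two interactions on the torus of side `L₁` are `N²ε'C`-close both ways
  have hper1 : ∀ y : Space, periodizedPotential (scaledPotential u b) L₁ y ≤
      periodizedPotential u L₁ y + ENNReal.ofReal ε' * C := fun y =>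
    (vb_periodizedPotential_le_of_pointwise (fun x => (hη b hb1 x).1) L₁ y).trans
      (add_le_add le_rfl (mul_le_mul' le_rfl (hC y)))
  have hper2 : ∀ y : Space, periodizedPotential u L₁ y ≤
      periodizedPotential (scaledPotential u b) L₁ y + ENNReal.ofReal ε' * C := fun y =>
    (vb_periodizedPotential_le_of_pointwise (fun x => (hη b hb1 x).2) L₁ y).trans
      (add_le_add le_rfl (mul_le_mul' le_rfl (hC y)))
  have hint1 := fun X : Config N => vb_periodicInteraction_le_of_periodized_le hper1 X
  have hint2 := fun X : Config N => vb_periodicInteraction_le_of_periodized_le hper2 X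
  -- so `Φ` and `Ψ₁` are `δ`-near-minimisers of `u` at `(N, L₁)`
  have hΦnear : periodicEnergy u Φ ≤ periodicGroundStateEnergy u N L₁ + δ :=
    (vb_nearMinimiser_of_minimiser hint1 hint2 Φ hΦmin).trans (add_le_add le_rfl hD)
  have hΨ₁near : periodicEnergy u Ψ₁ ≤ periodicGroundStateEnergy u N L₁ + δ := by
    rw [hE, hΨ₁, ← hE₀]
    exact le_self_add
  refine ⟨?_, ?_⟩
  · have h := hδ Φ Ψ₁ hΦnear hΨ₁near
    rwa [hn] at h
  · have h := hδ Ψ₁ Φ hΨ₁near hΦnear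
    rwa [hn] at h

end Summit.AtomisticToContinuum.BoseEinsteinCondensation.Theorems.CorrectorClosure.VolumeHomotopySumRuleDomination

end
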